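import Literature.MathematicalPhysics.QuantumFieldTheory.Balaban1983to89.B1Ineq225DerivDecayBackgroundTorus

/-!
# `Balaban1983to89.B1Ineq225RegularTorus` — T. Bałaban, *(Higgs)₂,₃ quantum fields in a finite volume. I. A lower bound*,
# Commun. Math. Phys. **85** (1982) 603–626 [Balaban1982Higgs1], Prop. 2.1 (2.25) — BOTH MEMBERS WITH THEIR DECAY FACTOR, ON `Ω = T_ε`,
# **AT EVERY (2.23)-REGULAR VECTOR FIELD `A`** of the (Higgs)₂,₃ carrier (no longer only the background `A^{(K),ε}` of gens 8–9):
# `|(G^ε_K(T_ε,A)g)(x)| ≦ c₀(L^Kε)²e^{−δ₀(L^Kε)⁻¹dist(x, supp g)}‖g‖_∞`, `|(D^ε_AG^ε_K(T_ε,A)g)(b)| ≦ c₀(L^Kε)e^{−δ₀(L^Kε)⁻¹dist(b₋, supp g)}‖g‖_∞`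
# for «e(L^kε) sufficiently small» — B4's Theorem (1.10) = [Balaban1983RegularityDecay] (2.12)–(2.13) ⇒ (2.22) on the torus with the
# per-cube Lemma 2.2 inputs of gens 8–9, the hypothesis being the print's (2.23) itself

statement-level skeleton of published theorems with citation tags; proofs where landed; nothing here is a claim about the Yang–Mills mass gap

PDF held: `paper:balaban1982-cmp85-higgs23-i` pp. 604–605, 610–611 [PDF 2–3, 8–9] (×2 renders p003/p008/p009 re-read by this seat);
`paper:balaban1983-cmp89-regularity-decay` pp. 572–573, 577–579 [PDF 2–3, 7–9].

CITATION HEADER (lean-in-tree rule).  Cell `lit-balaban` (HOME `run/shared/lean/pub/lit-balaban/`), Phase-2 proof seat **p35** gen 11 (unit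
`lit-balaban-p35`); SKELETON rows **B1.Prop2.1** ((2.25) both members WITH DECAY at EVERY (2.23)-regular `A`, `Ω = T_ε`: MODEL INSTANCE on the
(Higgs)₂,₃ carrier) and **B4.Thm@573** ((1.10) on the torus at a regular field, carrier instance).  USED BY NAME, never restated: gen 8's
`B1TorusCubeBoxOp.cube_inputs` (Lemma 2.2 value member + (2.20) factor on the torus cubes at `Ã_j`, ANY `A` regular in the chart form), gen 9's
`B1TorusCubeDerivInput.cube_input_deriv`, `B1TorusCubeDeriv.norm_covDeriv_hsmul_le` (Leibniz), `B1Ineq225DecayBackgroundTorus.{norm_propagatorK_univ_decay_le,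
eight_rS_le}`, `B1Ineq225DerivDecayBackgroundTorus.norm_covDeriv_propagatorK_univ_decay_le` (the walk (2.12)–(2.13) in the weighted sup norm, ANY
`A`, modulo cube inputs), `B1Ineq225BackgroundTorus.three_half_le_sites`, the typer's `HiggsLattice`/`HiggsCovariance`.
WHAT IS PRINTED.  [B1] p. 610 [PDF 8], verbatim: *"the rescaled propagator is given by G_k(Ω, A) = (−Δ^{η,N}_{A,Ω} + m²(L^kε)² + a_kP_k(A))^{−1}.
(2.22)"*; *"Proposition 2.1. Let a set Ω satisfies Ω = B^k(Ω^{(k)}) and let Ω^{(k)} ⊂ T₁^{(k)} be a sum of big blocks with M sufficiently large.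
Further, let a configuration A be regular on Ω in the sense that |(∂^η_μA)(x)| ≦ c(e(L^kε))^{β−1}, x ∈ Ω, μ = 1,…,d, (2.23) where
e(L^kε) = e(L^kε)^{(4−d)/2}, η = L^{−k}, β > 0 and c is some universal constant. … Then for e(L^kε) sufficiently small and α < 1 there exist
positive constants δ₀, c₀, R₀ independent of A, k, Ω and depending on d, a, M only, c₀ on α also, such that for an arbitrary function
f : Ω → R^N we have … |(D^η_{A,μ}G_k(Ω, A)f)(x)|, |(G_k(Ω, A)f)(x)| ≦ c₀ exp(−δ₀ dist(x, supp f))‖f‖_∞ (2.25) for x ∈ Ω, dist(x, Ω^c) ≧ R₀."*;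
p. 611 [PDF 9], verbatim: *"Let us notice that Ω^c means a complement in T_η, so in the case Ω = T_η the condition dist({x, x′}, Ω^c) ≧ R₀ is
meaningless and is omitted."*; p. 610 L1, verbatim: *"paper we will use the case Ω = T_ε only"*.  [B4] p. 572 [PDF 2], verbatim: *"The operators
we are going to define depend on A through the function U(A) = e^{qeηA}, q is an antisymmetric N × N matrix, where e is a real parameter. (1.2)"*.
READING PROVED HERE (unit conversions, not printed displays).  The carrier's field `A` lives on the bonds of `T_ε` with link variables
`U(A_b) = exp(qεeA_b)` ([B1] (1.7) p. 605); the rescaled field `A′` of (2.22)–(2.23) has `ηe(L^kε)A′_b = εeA_b`, so (2.23) reads, bond by bond,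
`(L^Kε|e|/e(L^Kε))·|A_ν(x + εe_μ) − A_ν(x)| ≦ c·e(L^Kε)^{β−1}/L^K` — the hypothesis `hreg` below with the effective coupling `e_K = e(L^Kε)` (any
normalisation `e_K > 0` is allowed; the theorems are uniform in it below the threshold `e_K ≦ e₁`, which is «e(L^kε) sufficiently small»);
(2.25) for the ε-lattice propagator (2.20) `G^ε_K = (L^Kε)²G_K` reads `|(G^ε_K(T_ε,A)g)(x)| ≦ c₀(L^Kε)²e^{−δ₀(L^Kε)⁻¹dist_ε(x, supp g)}‖g‖_∞` and
`|(D^ε_AG^ε_Kg)(b)| ≦ c₀(L^Kε)e^{−δ₀(L^Kε)⁻¹dist_ε(b₋, supp g)}‖g‖_∞` (`D/L^K = (L^Kε)⁻¹·εD` for the lattice-step distance `D`).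

WHAT THIS FILE PROVES (kernel-checked, zero `sorry`, theorems only; axioms standard).
* §1 `abs_acT_sub_le_of_reg` — the chart-form (1.7) hypothesis of the per-cube theorems (`h17`) FROM THE PRINTED (2.23) on the torus.
* §2 `cube_inputs_reg` — the four torus-walk inputs on every cube at `Ã_j` for EVERY (2.23)-regular `A` with `e_K ≦ e₁(K₀)`: value
  `‖G_j(h_jψ)‖_∞ ≦ C_γ(L^Kε)²‖ψ‖_∞`, cube-bond derivative `≦ C_δ(L^Kε)‖ψ‖_∞`, Leibniz'd torus derivative `‖D^ε_A(h_jG_j(h_jψ))‖_∞ ≦ C_T(L^Kε)‖ψ‖_∞`,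
  commutator `‖K_jG_j(h_jψ)‖_∞ ≦ (C_β/K₀)‖ψ‖_∞` (gens 8–9's per-cube theorems, whose field argument is already arbitrary).
* §3 **`norm_propagatorK_reg_decay_of_cubes`** — (2.25) VALUE MEMBER WITH DECAY AT EVERY REGULAR `A`: for `L ≧ 2`, `a, m² > 0`, `N`, `(e,q)`, a
  mesh cap `ε₀` and a regularity pair `(c, β)`, `c ≧ 0`, `β > 0`: constants `c₀ > 0`, `K₀min`, and per cube size `K₀` a threshold `e₁(K₀) > 0`
  and a rate `δ₀(K₀) > 0` such that for `K₀ ≧ K₀min`, on EVERY torus of the carrier with `K₀ ∣ M`, at every level `1 ≦ K ≦ K_P` with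
  `3·L^KK₀ ≦ |T_ε|_μ` and `L^Kε ≦ ε₀`, for EVERY vector field `A` and `0 < e_K ≦ e₁(K₀)` satisfying (2.23) (`hreg`), every `g` with
  `‖g‖_∞ ≦ M′` vanishing within lattice distance `D` of `x`: `‖(G^ε_K(T_ε,A)g)(x)‖ ≦ c₀(L^Kε)²e^{−δ₀(K₀)D/L^K}M′`.
* §4 **`norm_covDeriv_propagatorK_reg_decay_of_cubes`** — (2.25) DERIVATIVE MEMBER WITH DECAY at every regular `A`, same hypotheses:
  `‖(D^ε_AG^ε_K(T_ε,A)g)(b)‖ ≦ c₀(L^Kε)e^{−δ₀(K₀)D/L^K}M′` for `g` vanishing within lattice distance `D` of `b₋`.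
* §5 packagings `norm_propagatorK_reg_decay` / `norm_covDeriv_propagatorK_reg_decay` (cube condition as «`K₀ ∣ M`, `3K₀ ≦ 2M`»).
HONEST SCOPE.  `Ω = T_ε` only (the paper's own case, p. 610 L1; general big-block regions need [Balaban1983RegularityDecay] Lemma 2.1 at
boundary cubes for THIS carrier's composite contours (2.11), not in the tree); `m² > 0` ([B1] p. 605) with the cap `m²(L^Kε)² ≦ m²ε₀²`;
`L ≧ 2` (any parity), every `d ≧ 1`, every torus of the carrier (no shape condition); constants existential, functions of
`(d, L, a, m²ε₀², N, (e,q), c, β)` and of the cube size `K₀` (the print's `M`); the (2.24) Hölder clause at a regular `A` is the sequel file.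
Gens 8–9's `A^{(K),ε}` theorems are the instances `e_K = e₁`, `(c, β) = (1, ½)` of these (their (2.23) being `norm_sderiv_bgVec_le`), not re-derived
here.  Unit `lit-balaban-p35` gen 11 (literature-prover-lit-balaban-p35-g11-0).
-/

open scoped BigOperators

namespace Literature.MathematicalPhysics.QuantumFieldTheory.Balaban1983to89.B1Ineq225RegularTorus

open Literature.MathematicalPhysics.QuantumFieldTheory.Balaban1983to89.HiggsLattice (ChargeData sderiv covDeriv)
open Literature.MathematicalPhysics.QuantumFieldTheory.Balaban1983to89.HiggsCovariance (propagatorK covOpK)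
open Literature.MathematicalPhysics.QuantumFieldTheory.Balaban1983to89.B1TorusCubeCover (half Lab Near cube hTor)
open Literature.MathematicalPhysics.QuantumFieldTheory.Balaban1983to89.B1TorusCubeLocality26 (rS cubeVec)
open Literature.MathematicalPhysics.QuantumFieldTheory.Balaban1983to89.B1TorusCubeChart (dd dd_succ castD toT toT_add_e1 M2 predL_succ)
open Literature.MathematicalPhysics.QuantumFieldTheory.Balaban1983to89.B1TorusCubeBoxOp (acT cube_inputs)
open Literature.MathematicalPhysics.QuantumFieldTheory.Balaban1983to89.B4Lemma22ReduceZero (Box)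
open Literature.MathematicalPhysics.QuantumFieldTheory.Balaban1983to89.B4Lower18Regular (e1)
open Literature.MathematicalPhysics.QuantumFieldTheory.Balaban1983to89.B4PartitionUnity22 (hprof D1 D2 D1_nonneg D2_nonneg contDiff_hprof
  hasCompactSupport_hprof)
open Literature.MathematicalPhysics.QuantumFieldTheory.Balaban1983to89.B1Ineq225BackgroundTorus (three_half_le_sites)
open Literature.MathematicalPhysics.QuantumFieldTheory.Balaban1983to89.B1Ineq225DecayBackgroundTorus (norm_propagatorK_univ_decay_le eight_rS_le)
open Literature.MathematicalPhysics.QuantumFieldTheory.Balaban1983to89.B1Ineq225DerivDecayBackgroundTorus (norm_covDeriv_propagatorK_univ_decay_le)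
open Literature.MathematicalPhysics.QuantumFieldTheory.Balaban1983to89.B1TorusCubeDeriv (norm_covDeriv_hsmul_le)
open Literature.MathematicalPhysics.QuantumFieldTheory.Balaban1983to89.B1TorusCubeDerivInput (cube_input_deriv)

variable {P : HiggsLattice.Params} {N : ℕ}

/-! ## §1 The printed regularity (2.23) on the torus gives the chart-form hypothesis of the per-cube theorems -/

section Regularity

variable {K K₀ : ℕ}

/-- `|σ|` for the chart scaling `σ = L^K·ε·e/e_K`: `|σ| = (L^Kε)|e|/e_K`. [cite: Balaban1982Higgs1, (1.7) p.605, dictionary] -/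
theorem abs_chartScale (C : ChargeData N) (K : ℕ) {ec : ℝ} (hec : 0 < ec) :
    |((((P.L - 1 + 1) ^ K : ℕ)) : ℝ) * P.mesh 0 * C.e / ec| = P.mesh K * |C.e| / ec := by
  have hnR : ((((P.L - 1 + 1) ^ K : ℕ)) : ℝ) = (P.L : ℝ) ^ K := by rw [predL_succ, Nat.cast_pow]
  have hmeshK : P.mesh K = (P.L : ℝ) ^ K * P.mesh 0 := by unfold HiggsLattice.Params.mesh; ring
  have hpow : (0 : ℝ) < (P.L : ℝ) ^ K := by have := P.hL; positivity
  rw [hnR, abs_div, abs_mul, abs_mul, abs_of_pos hpow, abs_of_pos (P.mesh_pos 0), abs_of_pos hec, hmeshK]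

/-- **(2.23) ⇒ THE CHART-FORM (1.7) OF THE PER-CUBE THEOREMS.**  If the carrier's vector field satisfies, bond by bond,
`(L^Kε|e|/e_K)·|A_ν(x + εe_μ) − A_ν(x)| ≦ c·e_K^{β−1}/L^K` (the printed (2.23) `|∂^η_μA′| ≦ c·e(L^kε)^{β−1}` for the rescaled field `A′` with
`ηe(L^kε)A′ = εeA`, `e_K = e(L^kε)`), then on every cube chart the transcribed field `acT` (charge normalised to `e_K`) satisfies the hypothesis `h17`
of `B1TorusCubeBoxOp.cube_inputs` / `B1TorusCubeDerivInput.cube_input_deriv` / `B1TorusCubeHolderInput.cube_input_holder` with the pair `(c, β)`.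
[cite: Balaban1982Higgs1, Prop. 2.1 (2.23) p.610] [cite: Balaban1983RegularityDecay, (1.7) p.572] -/
theorem abs_acT_sub_le_of_reg (C : ChargeData N) (j : Lab P K K₀) (A : HiggsLattice.VecField P 0) {ec creg β : ℝ} (hec : 0 < ec)
    (hreg : ∀ (x : HiggsLattice.Site P 0) (μ ν : Fin P.d),
      P.mesh K * |C.e| / ec * |A ⟨x.shift μ, ν⟩ - A ⟨x, ν⟩| ≤ creg * ec ^ (β - 1) / (P.L : ℝ) ^ K) :
    ∀ y ∈ Box (dd P) (P.L - 1) K (M2 P K₀), ∀ i i' : Fin (dd P + 1),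
      |acT K K₀ j ((((P.L - 1 + 1) ^ K : ℕ) : ℝ) * P.mesh 0 * C.e / ec) A (y + e1 i) i'
        - acT K K₀ j ((((P.L - 1 + 1) ^ K : ℕ) : ℝ) * P.mesh 0 * C.e / ec) A y i'|
        ≤ creg * ec ^ (β - 1) / ((P.L - 1 + 1) ^ K : ℕ) := by
  intro y _ i i'
  have hnR : ((((P.L - 1 + 1) ^ K : ℕ)) : ℝ) = (P.L : ℝ) ^ K := by rw [predL_succ, Nat.cast_pow]
  unfold acT
  rw [toT_add_e1, ← mul_sub, abs_mul, abs_chartScale C K hec, hnR]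
  exact hreg _ _ _

end Regularity

/-! ## §2 The four torus-walk inputs on the cubes, at every (2.23)-regular field -/

section CubeInputs

set_option maxHeartbeats 400000 in
/-- **THE CUBE INPUTS AT `Ã_j` FOR EVERY (2.23)-REGULAR FIELD.**  For `L ≧ 2` (`ℓ0 = L − 1 ≧ 1`), `a > 0`, `m² > 0`, a mass cap `m²₊` and a
regularity pair `(c, β)`: constants `C_γ, C_δ, C_T, C_β > 0` and per cube size `K₀ ≧ 8` a threshold `e₁(K₀) > 0` such that on every torus of the
carrier (`dd P = d0`, `P.L − 1 = ℓ0`, `K₀ ∣ M`), at every level `1 ≦ K ≦ K_P` with `3·L^KK₀ ≦ |T_ε|_μ` and `m²(L^Kε)² ≦ m²₊`, for EVERY vector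
field `A` and effective coupling `0 < e_K ≦ e₁(K₀)` with (2.23) (`hreg`), on every cube `□_j`, with `u_j = G_K(□_j, Ã_j)(h_jψ)`:
`‖u_j‖_∞ ≦ C_γ(L^Kε)²‖ψ‖_∞` (Lemma 2.2 (2.17) value member), `‖D^ε_{Ã_j}u_j(b)‖ ≦ C_δ(L^Kε)‖ψ‖_∞` on the bonds of `□_j` ((2.17) derivative member),
`‖D^ε_A(h_ju_j)‖_∞ ≦ C_T(L^Kε)‖ψ‖_∞` (Leibniz, «|∂^ηh_j| ≦ O(M^{−1})»), `‖(H_jh_j − h_jH_j)u_j‖_∞ ≦ (C_β/K₀)‖ψ‖_∞` ((2.20)).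
[cite: Balaban1982Higgs1, Prop. 2.1 (2.23) p.610] [cite: Balaban1983RegularityDecay, Lemma 2.2 (2.17) p.578, (2.20) p.578, p.577] -/
theorem cube_inputs_reg (C : ChargeData N) (d0 ℓ0 : ℕ) (hℓ0 : 1 ≤ ℓ0) {a : ℝ} (ha : 0 < a) {msq : ℝ} (hmsq : 0 < msq) (m2plus : ℝ)
    (creg β : ℝ) (hcreg : 0 ≤ creg) (hβ : 0 < β) :
    ∃ Cγ Cδ CT Cβ : ℝ, 0 < Cγ ∧ 0 < Cδ ∧ 0 < CT ∧ 0 < Cβ ∧ ∃ e₁ : ℕ → ℝ, (∀ K₀, 0 < e₁ K₀) ∧ ∀ K₀ : ℕ, 8 ≤ K₀ →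
      ∀ (P : HiggsLattice.Params), dd P = d0 → P.L - 1 = ℓ0 → ∀ {K : ℕ}, 1 ≤ K → K ≤ P.K → K₀ ∣ P.M →
      (∀ μ, 3 * half P K K₀ ≤ P.sitesPerDir 0 μ) → msq * P.mesh K ^ 2 ≤ m2plus →
      ∀ (A : HiggsLattice.VecField P 0) {ec : ℝ}, 0 < ec → ec ≤ e₁ K₀ →
      (∀ (x : HiggsLattice.Site P 0) (μ ν : Fin P.d),
          P.mesh K * |C.e| / ec * |A ⟨x.shift μ, ν⟩ - A ⟨x, ν⟩| ≤ creg * ec ^ (β - 1) / (P.L : ℝ) ^ K) →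
      ∀ j : Lab P K K₀,
        (∀ ψ : HiggsLattice.ScalarField P 0 N,
            ‖propagatorK C (cube K K₀ j) (cubeVec K K₀ j A) msq a K (hTor K K₀ j • ψ)‖ ≤ Cγ * P.mesh K ^ 2 * ‖ψ‖) ∧
        (∀ (ψ : HiggsLattice.ScalarField P 0 N) (x : HiggsLattice.Site P 0) (μ : Fin P.d), x ∈ cube K K₀ j → x.shift μ ∈ cube K K₀ j →
            ‖covDeriv C (cubeVec K K₀ j A) (propagatorK C (cube K K₀ j) (cubeVec K K₀ j A) msq a K (hTor K K₀ j • ψ)) ⟨x, μ⟩‖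
              ≤ Cδ * P.mesh K * ‖ψ‖) ∧
        (∀ ψ : HiggsLattice.ScalarField P 0 N,
            ‖(fun b => covDeriv C A (hTor K K₀ j • propagatorK C (cube K K₀ j) (cubeVec K K₀ j A) msq a K (hTor K K₀ j • ψ)) b :
              HiggsLattice.PBond P 0 → EuclideanSpace ℝ (Fin N))‖ ≤ CT * P.mesh K * ‖ψ‖) ∧
        (∀ ψ : HiggsLattice.ScalarField P 0 N,
            ‖covOpK C (cube K K₀ j) (cubeVec K K₀ j A) msq a K
                (hTor K K₀ j • propagatorK C (cube K K₀ j) (cubeVec K K₀ j A) msq a K (hTor K K₀ j • ψ))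
              - hTor K K₀ j • covOpK C (cube K K₀ j) (cubeVec K K₀ j A) msq a K
                (propagatorK C (cube K K₀ j) (cubeVec K K₀ j A) msq a K (hTor K K₀ j • ψ))‖ ≤ Cβ / K₀ * ‖ψ‖) := by
  -- the constants of the cube inputs (Lemma 2.2 at charge normalised to `e_K`: value/(2.20) and derivative members)
  obtain ⟨Cγ, Cβ, hCγ, hCβ, hci⟩ := cube_inputs C d0 ℓ0 hℓ0 a a m2plus ha
  obtain ⟨Cδ, hCδ, hdi⟩ := cube_input_deriv C d0 ℓ0 hℓ0 a a m2plus ha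
  have hD1 := D1_nonneg contDiff_hprof hasCompactSupport_hprof
  have hD2 := D2_nonneg contDiff_hprof hasCompactSupport_hprof
  -- the two thresholds for the pair `(c, β)`, as functions of the cube size
  have hci' : ∀ K₀ : ℕ, ∃ e₁ : ℝ, 0 < e₁ ∧ _ := fun K₀ => hci creg β hcreg hβ (max K₀ 8) (le_max_right _ _)
  have hdi' : ∀ K₀ : ℕ, ∃ e₁ : ℝ, 0 < e₁ ∧ _ := fun K₀ => hdi creg β hcreg hβ (max K₀ 8) (le_max_right _ _)
  choose e₁ he₁ hthr' using hci'
  choose e₂ he₂ hdthr' using hdi'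
  refine ⟨Cγ, Cδ, Cδ + ((d0 : ℝ) + 1) * (D1 hprof + D2 hprof) / 8 * Cγ, Cβ, hCγ, hCδ, by positivity, hCβ,
    fun K₀ => min (e₁ K₀) (e₂ K₀), fun K₀ => lt_min (he₁ K₀) (he₂ K₀), fun K₀ hK₀8 => ?_⟩
  have hmax : max K₀ 8 = K₀ := max_eq_left hK₀8
  have hthr := hthr' K₀
  have hdthr := hdthr' K₀
  rw [hmax] at hthr hdthr
  intro P hPd hPL K hK1 hK hK₀M hN3 hcap A ec hec hle hreg j
  have hec1 : ec ≤ e₁ K₀ := hle.trans (min_le_left _ _)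
  have hec2 : ec ≤ e₂ K₀ := hle.trans (min_le_right _ _)
  have hmesh : 0 < P.mesh K := P.mesh_pos K
  have hK₀' : 1 ≤ K₀ := le_trans (by norm_num) hK₀8
  have hK₀r : (0 : ℝ) < K₀ := by exact_mod_cast hK₀'
  have h17 := abs_acT_sub_le_of_reg C j A hec hreg
  have hGK := hthr P hPd hPL K hK1 hK hK₀M hN3 a msq le_rfl le_rfl hmsq hcap j A ec hec hec1 h17
  have hDD := hdthr P hPd hPL K hK1 hK hK₀M hN3 a msq le_rfl le_rfl hmsq hcap j A ec hec hec2 h17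
  refine ⟨hGK.1, hDD, fun ψ => ?_, hGK.2⟩
  -- Leibniz assembly: `γ_D = C_δ(L^Kε)‖ψ‖`, `γ₀ = C_γ(L^Kε)²‖ψ‖`
  have hψ0 : 0 ≤ ‖ψ‖ := norm_nonneg _
  have hu : ∀ x, ‖propagatorK C (cube K K₀ j) (cubeVec K K₀ j A) msq a K (hTor K K₀ j • ψ) x‖ ≤ Cγ * P.mesh K ^ 2 * ‖ψ‖ :=
    fun x => (norm_le_pi_norm _ x).trans (hGK.1 ψ)
  have hmain := norm_covDeriv_hsmul_le C hK hK₀M hK₀8 hN3 j A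
    (propagatorK C (cube K K₀ j) (cubeVec K K₀ j A) msq a K (hTor K K₀ j • ψ)) (γD := Cδ * P.mesh K * ‖ψ‖)
    (γ0 := Cγ * P.mesh K ^ 2 * ‖ψ‖) (by positivity) (by positivity) (fun x μ hx hs => hDD ψ x μ hx hs) hu
  refine hmain.trans ?_
  subst hPd
  have h8 : ((dd P : ℝ) + 1) * (D1 hprof + D2 hprof) / K₀ ≤ ((dd P : ℝ) + 1) * (D1 hprof + D2 hprof) / 8 :=
    div_le_div_of_nonneg_left (by positivity) (by norm_num) (by exact_mod_cast hK₀8)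
  have e : ((dd P : ℝ) + 1) * (D1 hprof + D2 hprof) / K₀ * (P.mesh K)⁻¹ * (Cγ * P.mesh K ^ 2 * ‖ψ‖)
      = ((dd P : ℝ) + 1) * (D1 hprof + D2 hprof) / K₀ * (Cγ * P.mesh K * ‖ψ‖) := by
    field_simp
  rw [e]
  calc Cδ * P.mesh K * ‖ψ‖ + ((dd P : ℝ) + 1) * (D1 hprof + D2 hprof) / K₀ * (Cγ * P.mesh K * ‖ψ‖)
      ≤ Cδ * P.mesh K * ‖ψ‖ + ((dd P : ℝ) + 1) * (D1 hprof + D2 hprof) / 8 * (Cγ * P.mesh K * ‖ψ‖) := by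
        gcongr
    _ = (Cδ + ((dd P : ℝ) + 1) * (D1 hprof + D2 hprof) / 8 * Cγ) * P.mesh K * ‖ψ‖ := by ring

end CubeInputs

/-! ## §3 (2.25), value member with its decay factor, on `T_ε`, at every (2.23)-regular field -/

section Main

/-- the cube-size bookkeeping shared by §3 and §4: for `K₀ ≧ 2^{d+2}C_β` the smallness `2^d(C_β/K₀)e^{δ·2rS} ≦ ½` holds with the rate
`δ = log 2/(2rS)` (`e^{δ·2rS} = 2`). [folklore] -/
private theorem smallness_of_K₀ {d K₀ : ℕ} {Cβ : ℝ} (hK₀8 : 8 ≤ K₀) (hK₀C : (2 : ℝ) ^ d * 4 * Cβ ≤ K₀) {E : ℝ} (hE : E = 2) :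
    (2 : ℝ) ^ d * (Cβ / K₀) * E ≤ 1 / 2 := by
  have hK₀pos : (0 : ℝ) < K₀ := by exact_mod_cast (show 0 < K₀ by omega)
  rw [hE]
  have e : (2 : ℝ) ^ d * (Cβ / K₀) * 2 = (2 ^ d * 2 * Cβ) / K₀ := by ring
  rw [e, div_le_iff₀ hK₀pos]
  nlinarith [pow_pos (two_pos : (0 : ℝ) < 2) d, (show (0 : ℝ) ≤ 2 ^ d * 4 * Cβ - 2 ^ d * 4 * Cβ by simp)]

/-- the rate bookkeeping shared by §3 and §4: `δ₀(K₀)·D/L^K ≦ δ·D` for `δ = log 2/(2rS)`, from `8rS ≦ (5K₀ + 8)L^K`, hence the comparison of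
the exponential factors. [folklore] -/
private theorem exp_rate_le {K K₀ : ℕ} {D : ℝ} (hD0 : 0 ≤ D) :
    Real.exp (-(Real.log 2 / (2 * (rS P K K₀ : ℝ)) * D))
      ≤ Real.exp (-(Real.log 2 * 4 / (5 * (K₀ : ℝ) + 8) * (D / (P.L : ℝ) ^ K))) := by
  have hlog2 : 0 < Real.log 2 := Real.log_pos (by norm_num)
  have hrS : (0 : ℝ) < rS P K K₀ := by
    have : 1 ≤ rS P K K₀ := by unfold rS; have := Nat.one_le_pow K P.L P.hL; omega
    exact_mod_cast this
  have hLK : (0 : ℝ) < (P.L : ℝ) ^ K := by have := P.hL; positivity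
  have h8 : 8 * (rS P K K₀ : ℝ) ≤ (5 * (K₀ : ℝ) + 8) * (P.L : ℝ) ^ K := by
    have h := eight_rS_le (P := P) (K := K) (K₀ := K₀)
    have h' : ((8 * rS P K K₀ : ℕ) : ℝ) ≤ ((5 * half P K K₀ + 8 * P.L ^ K : ℕ) : ℝ) := by exact_mod_cast h
    unfold half at h'
    push_cast at h'
    linarith
  have hcmp : Real.log 2 * 4 / (5 * (K₀ : ℝ) + 8) * (D / (P.L : ℝ) ^ K) ≤ Real.log 2 / (2 * (rS P K K₀ : ℝ)) * D := by
    rw [div_mul_div_comm, div_mul_eq_mul_div, div_le_div_iff₀ (by positivity) (by positivity)]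
    have hlogD : 0 ≤ Real.log 2 * D := mul_nonneg hlog2.le hD0
    calc Real.log 2 * 4 * D * (2 * (rS P K K₀ : ℝ)) = Real.log 2 * D * (8 * (rS P K K₀ : ℝ)) := by ring
      _ ≤ Real.log 2 * D * ((5 * (K₀ : ℝ) + 8) * (P.L : ℝ) ^ K) := mul_le_mul_of_nonneg_left h8 hlogD
  exact Real.exp_le_exp.2 (by linarith)

/-- **PROP. 2.1 (2.25), VALUE MEMBER WITH ITS DECAY FACTOR, ON `Ω = T_ε`, AT EVERY (2.23)-REGULAR VECTOR FIELD `A` OF THE (Higgs)₂,₃ CARRIER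
— B4's THEOREM (1.10) VALUE MEMBER ON THE TORUS.**  For `d`, `L ≧ 2`, `a > 0`, `m² > 0`, `N`, `(e, q)`, a mesh cap `ε₀` and a regularity pair
`c ≧ 0`, `β > 0`: constants `c₀ > 0`, `K₀min`, and per cube size `K₀` a threshold `e₁(K₀) > 0` («e(L^kε) sufficiently small») and a rate
`δ₀(K₀) > 0` («δ₀ … depending on d, M only»: `K₀` is the print's `M`) such that for `K₀ ≧ K₀min`, on EVERY torus of the carrier with `K₀ ∣ M`,
at every level `1 ≦ K ≦ K_P` with `3·L^KK₀ ≦ |T_ε|_μ`, `L^Kε ≦ ε₀`, for EVERY vector field `A` and `0 < e_K ≦ e₁(K₀)` with (2.23) in the form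
`(L^Kε|e|/e_K)|A_ν(x + εe_μ) − A_ν(x)| ≦ c·e_K^{β−1}/L^K`, every `g` with `‖g‖_∞ ≦ M′` vanishing at the sites within lattice distance `< D` of `x`
(`D ≧ 0`): `‖(G^ε_K(T_ε, A)g)(x)‖ ≦ c₀(L^Kε)²·exp(−δ₀(K₀)·D/L^K)·M′`.  Proof = the walk `norm_propagatorK_univ_decay_le` (ANY `A`) fed with §2,
`δ = log 2/(2rS)`, `δ₀(K₀) = 4 log 2/(5K₀ + 8)`. [cite: Balaban1982Higgs1, Prop. 2.1 (2.23), (2.25) p.610]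
[cite: Balaban1983RegularityDecay, Theorem (1.10) p.573; (2.22) p.579] -/
theorem norm_propagatorK_reg_decay_of_cubes (d L : ℕ) (hL : 2 ≤ L) {a : ℝ} (ha : 0 < a) {msq : ℝ} (hmsq : 0 < msq) (N : ℕ)
    (C : ChargeData N) (ε₀ : ℝ) (creg β : ℝ) (hcreg : 0 ≤ creg) (hβ : 0 < β) :
    ∃ c₀ : ℝ, 0 < c₀ ∧ ∃ K₀min : ℕ, ∃ e₁ δA : ℕ → ℝ, (∀ K₀, 0 < e₁ K₀ ∧ 0 < δA K₀) ∧ ∀ K₀ : ℕ, K₀min ≤ K₀ →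
      ∀ (P : HiggsLattice.Params), P.d = d → P.L = L → K₀ ∣ P.M →
      ∀ {K : ℕ}, 1 ≤ K → K ≤ P.K → (∀ μ, 3 * half P K K₀ ≤ P.sitesPerDir 0 μ) → P.mesh K ≤ ε₀ →
      ∀ (A : HiggsLattice.VecField P 0) {ec : ℝ}, 0 < ec → ec ≤ e₁ K₀ →
      (∀ (x : HiggsLattice.Site P 0) (μ ν : Fin P.d),
          P.mesh K * |C.e| / ec * |A ⟨x.shift μ, ν⟩ - A ⟨x, ν⟩| ≤ creg * ec ^ (β - 1) / (P.L : ℝ) ^ K) →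
        ∀ (g : HiggsLattice.ScalarField P 0 N) (M D : ℝ), (∀ x, ‖g x‖ ≤ M) → 0 ≤ D →
          ∀ x, (∀ z, g z ≠ 0 → D ≤ (HiggsLattice.Site.tdist x z : ℝ)) →
            ‖propagatorK C Finset.univ A msq a K g x‖ ≤ c₀ * P.mesh K ^ 2 * Real.exp (-(δA K₀ * (D / (P.L : ℝ) ^ K))) * M := by
  have hℓ0 : 1 ≤ L - 1 := by omega
  obtain ⟨Cγ, Cδ, CT, Cβ, hCγ, hCδ, hCT, hCβ, e₁, he₁, hcube⟩ :=
    cube_inputs_reg C (d - 1) (L - 1) hℓ0 ha hmsq (msq * ε₀ ^ 2) creg β hcreg hβ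
  have hlog2 : 0 < Real.log 2 := Real.log_pos (by norm_num)
  refine ⟨4 * 2 ^ d * Cγ, by positivity, max 8 (⌈(2 : ℝ) ^ (d + 2) * Cβ⌉₊), e₁, fun K₀ => Real.log 2 * 4 / (5 * K₀ + 8),
    fun K₀ => ⟨he₁ K₀, div_pos (mul_pos hlog2 (by norm_num)) (by positivity)⟩, fun K₀ hK₀ => ?_⟩
  have hK₀8 : 8 ≤ K₀ := le_trans (le_max_left _ _) hK₀
  have hK₀C : (2 : ℝ) ^ (d + 2) * Cβ ≤ K₀ :=
    (Nat.le_ceil _).trans (by exact_mod_cast le_trans (le_max_right _ _) hK₀)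
  have h22 : (2 : ℝ) ^ (d + 2) = 2 ^ d * 4 := by rw [pow_add]; norm_num
  rw [h22] at hK₀C
  intro P hPd hPL hK₀M K hK1 hK hN3 hε A ec hec hle hreg g M D hg hD0 x hD
  have hdd : dd P = d - 1 := by rw [← hPd]; rfl
  have hPL1 : P.L - 1 = L - 1 := by rw [hPL]
  have hmesh : 0 < P.mesh K := P.mesh_pos K
  have hcap : msq * P.mesh K ^ 2 ≤ msq * ε₀ ^ 2 :=
    mul_le_mul_of_nonneg_left (pow_le_pow_left₀ hmesh.le hε 2) hmsq.le
  have hcj := fun j => hcube K₀ hK₀8 P hdd hPL1 hK1 hK hK₀M hN3 hcap A hec hle hreg j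
  subst hPd
  have hL1 : (1 : ℝ) < P.L := by rw [hPL]; exact_mod_cast (show 1 < L by omega)
  have hakP : 0 ≤ B1.aSeq a P.L K := (B1.aSeq_pos ha hL1 hK1).le
  have hM0 : 0 ≤ M := (norm_nonneg _).trans (hg x)
  -- the rate `δ = log 2/(2rS)`: `e^{δ·2rS} = 2`
  have hrS : (0 : ℝ) < rS P K K₀ := by
    have : 1 ≤ rS P K K₀ := by unfold rS; have := Nat.one_le_pow K P.L P.hL; omega
    exact_mod_cast this
  set δ : ℝ := Real.log 2 / (2 * rS P K K₀) with hδ_def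
  have hδ0 : 0 ≤ δ := by positivity
  have hexp : Real.exp (δ * (2 * rS P K K₀)) = 2 := by
    rw [hδ_def, div_mul_cancel₀ _ (by positivity), Real.exp_log two_pos]
  have hsmall : (2 : ℝ) ^ P.d * (Cβ / K₀) * Real.exp (δ * (2 * rS P K K₀)) ≤ 1 / 2 := smallness_of_K₀ hK₀8 hK₀C hexp
  have hmain := norm_propagatorK_univ_decay_le C hK hK₀M hK₀8 hmsq a hakP A (γ := Cγ * P.mesh K ^ 2)
    (β := Cβ / K₀) (by positivity) (by positivity) (fun j ψ => (hcj j).1 ψ) (fun j ψ => (hcj j).2.2.2 ψ) hδ0 hsmall g hg hD0 x hD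
  rw [hexp] at hmain
  have hexpD := exp_rate_le (P := P) (K := K) (K₀ := K₀) hD0
  calc ‖propagatorK C Finset.univ A msq a K g x‖
      ≤ 2 * 2 ^ P.d * (Cγ * P.mesh K ^ 2 * 2) * Real.exp (-(δ * D)) * M := hmain
    _ ≤ 2 * 2 ^ P.d * (Cγ * P.mesh K ^ 2 * 2) * Real.exp (-(Real.log 2 * 4 / (5 * (K₀ : ℝ) + 8) * (D / (P.L : ℝ) ^ K))) * M :=
        mul_le_mul_of_nonneg_right (mul_le_mul_of_nonneg_left hexpD (by positivity)) hM0
    _ = 4 * 2 ^ P.d * Cγ * P.mesh K ^ 2 * Real.exp (-(Real.log 2 * 4 / (5 * (K₀ : ℝ) + 8) * (D / (P.L : ℝ) ^ K))) * M := by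
        ring

/-! ## §4 (2.25), derivative member with its decay factor, on `T_ε`, at every (2.23)-regular field -/

/-- **PROP. 2.1 (2.25), DERIVATIVE MEMBER WITH ITS DECAY FACTOR, ON `Ω = T_ε`, AT EVERY (2.23)-REGULAR VECTOR FIELD `A` — B4's THEOREM (1.10)
DERIVATIVE MEMBER ON THE TORUS.**  Same data and hypotheses as `norm_propagatorK_reg_decay_of_cubes`; for every bond `b` and every `g` with
`‖g‖_∞ ≦ M′` vanishing at the sites within lattice distance `< D` of `b₋`: `‖(D^ε_AG^ε_K(T_ε, A)g)(b)‖ ≦ c₀(L^Kε)·exp(−δ₀(K₀)·D/L^K)·M′`.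
Proof = the observable walk `norm_covDeriv_propagatorK_univ_decay_le` (ANY `A`) fed with §2's Leibniz'd input `C_T`.
[cite: Balaban1982Higgs1, Prop. 2.1 (2.23), (2.25) p.610] [cite: Balaban1983RegularityDecay, Theorem (1.10) p.573; (2.22) p.579] -/
theorem norm_covDeriv_propagatorK_reg_decay_of_cubes (d L : ℕ) (hL : 2 ≤ L) {a : ℝ} (ha : 0 < a) {msq : ℝ} (hmsq : 0 < msq) (N : ℕ)
    (C : ChargeData N) (ε₀ : ℝ) (creg β : ℝ) (hcreg : 0 ≤ creg) (hβ : 0 < β) :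
    ∃ c₀ : ℝ, 0 < c₀ ∧ ∃ K₀min : ℕ, ∃ e₁ δA : ℕ → ℝ, (∀ K₀, 0 < e₁ K₀ ∧ 0 < δA K₀) ∧ ∀ K₀ : ℕ, K₀min ≤ K₀ →
      ∀ (P : HiggsLattice.Params), P.d = d → P.L = L → K₀ ∣ P.M →
      ∀ {K : ℕ}, 1 ≤ K → K ≤ P.K → (∀ μ, 3 * half P K K₀ ≤ P.sitesPerDir 0 μ) → P.mesh K ≤ ε₀ →
      ∀ (A : HiggsLattice.VecField P 0) {ec : ℝ}, 0 < ec → ec ≤ e₁ K₀ →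
      (∀ (x : HiggsLattice.Site P 0) (μ ν : Fin P.d),
          P.mesh K * |C.e| / ec * |A ⟨x.shift μ, ν⟩ - A ⟨x, ν⟩| ≤ creg * ec ^ (β - 1) / (P.L : ℝ) ^ K) →
        ∀ (g : HiggsLattice.ScalarField P 0 N) (M D : ℝ), (∀ x, ‖g x‖ ≤ M) → 0 ≤ D →
          ∀ b : HiggsLattice.PBond P 0, (∀ z, g z ≠ 0 → D ≤ (HiggsLattice.Site.tdist b.src z : ℝ)) →
            ‖covDeriv C A (propagatorK C Finset.univ A msq a K g) b‖
              ≤ c₀ * P.mesh K * Real.exp (-(δA K₀ * (D / (P.L : ℝ) ^ K))) * M := by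
  have hℓ0 : 1 ≤ L - 1 := by omega
  obtain ⟨Cγ, Cδ, CT, Cβ, hCγ, hCδ, hCT, hCβ, e₁, he₁, hcube⟩ :=
    cube_inputs_reg C (d - 1) (L - 1) hℓ0 ha hmsq (msq * ε₀ ^ 2) creg β hcreg hβ
  have hlog2 : 0 < Real.log 2 := Real.log_pos (by norm_num)
  refine ⟨4 * 2 ^ d * CT, by positivity, max 8 (⌈(2 : ℝ) ^ (d + 2) * Cβ⌉₊), e₁, fun K₀ => Real.log 2 * 4 / (5 * K₀ + 8),
    fun K₀ => ⟨he₁ K₀, div_pos (mul_pos hlog2 (by norm_num)) (by positivity)⟩, fun K₀ hK₀ => ?_⟩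
  have hK₀8 : 8 ≤ K₀ := le_trans (le_max_left _ _) hK₀
  have hK₀C : (2 : ℝ) ^ (d + 2) * Cβ ≤ K₀ :=
    (Nat.le_ceil _).trans (by exact_mod_cast le_trans (le_max_right _ _) hK₀)
  have h22 : (2 : ℝ) ^ (d + 2) = 2 ^ d * 4 := by rw [pow_add]; norm_num
  rw [h22] at hK₀C
  intro P hPd hPL hK₀M K hK1 hK hN3 hε A ec hec hle hreg g M D hg hD0 b hD
  have hdd : dd P = d - 1 := by rw [← hPd]; rfl
  have hPL1 : P.L - 1 = L - 1 := by rw [hPL]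
  have hmesh : 0 < P.mesh K := P.mesh_pos K
  have hcap : msq * P.mesh K ^ 2 ≤ msq * ε₀ ^ 2 :=
    mul_le_mul_of_nonneg_left (pow_le_pow_left₀ hmesh.le hε 2) hmsq.le
  have hcj := fun j => hcube K₀ hK₀8 P hdd hPL1 hK1 hK hK₀M hN3 hcap A hec hle hreg j
  subst hPd
  have hL1 : (1 : ℝ) < P.L := by rw [hPL]; exact_mod_cast (show 1 < L by omega)
  have hakP : 0 ≤ B1.aSeq a P.L K := (B1.aSeq_pos ha hL1 hK1).le
  have hM0 : 0 ≤ M := (norm_nonneg _).trans (hg b.src)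
  have hrS : (0 : ℝ) < rS P K K₀ := by
    have : 1 ≤ rS P K K₀ := by unfold rS; have := Nat.one_le_pow K P.L P.hL; omega
    exact_mod_cast this
  set δ : ℝ := Real.log 2 / (2 * rS P K K₀) with hδ_def
  have hδ0 : 0 ≤ δ := by positivity
  have hexp : Real.exp (δ * (2 * rS P K K₀)) = 2 := by
    rw [hδ_def, div_mul_cancel₀ _ (by positivity), Real.exp_log two_pos]
  have hsmall : (2 : ℝ) ^ P.d * (Cβ / K₀) * Real.exp (δ * (2 * rS P K K₀)) ≤ 1 / 2 := smallness_of_K₀ hK₀8 hK₀C hexp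
  have hmain := norm_covDeriv_propagatorK_univ_decay_le C hK hK₀M hK₀8 hmsq a hakP A (γT := CT * P.mesh K)
    (β := Cβ / K₀) (by positivity) (by positivity) (fun j ψ => (hcj j).2.2.1 ψ) (fun j ψ => (hcj j).2.2.2 ψ) hδ0 hsmall g hg hD0 b hD
  rw [hexp] at hmain
  have hexpD := exp_rate_le (P := P) (K := K) (K₀ := K₀) hD0
  calc ‖covDeriv C A (propagatorK C Finset.univ A msq a K g) b‖
      ≤ 2 * 2 ^ P.d * (CT * P.mesh K * 2) * Real.exp (-(δ * D)) * M := hmain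
    _ ≤ 2 * 2 ^ P.d * (CT * P.mesh K * 2) * Real.exp (-(Real.log 2 * 4 / (5 * (K₀ : ℝ) + 8) * (D / (P.L : ℝ) ^ K))) * M :=
        mul_le_mul_of_nonneg_right (mul_le_mul_of_nonneg_left hexpD (by positivity)) hM0
    _ = 4 * 2 ^ P.d * CT * P.mesh K * Real.exp (-(Real.log 2 * 4 / (5 * (K₀ : ℝ) + 8) * (D / (P.L : ℝ) ^ K))) * M := by ring

/-! ## §5 Packagings with the cube condition «`K₀ ∣ M`, `3K₀ ≦ 2M`» -/

/-- **(2.25) VALUE MEMBER AT EVERY REGULAR `A`, CUBE CONDITION AS «`K₀ ∣ M`, `3K₀ ≦ 2M`»** (then `3·L^KK₀ ≦ |T_ε|_μ` at every level `K ≦ K_P`).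
[cite: Balaban1982Higgs1, Prop. 2.1 (2.23), (2.25) p.610] [cite: Balaban1983RegularityDecay, Theorem (1.10) p.573] -/
theorem norm_propagatorK_reg_decay (d L : ℕ) (hL : 2 ≤ L) {a : ℝ} (ha : 0 < a) {msq : ℝ} (hmsq : 0 < msq) (N : ℕ)
    (C : ChargeData N) (ε₀ : ℝ) (creg β : ℝ) (hcreg : 0 ≤ creg) (hβ : 0 < β) :
    ∃ c₀ : ℝ, 0 < c₀ ∧ ∃ K₀min : ℕ, ∃ e₁ δA : ℕ → ℝ, (∀ K₀, 0 < e₁ K₀ ∧ 0 < δA K₀) ∧ ∀ K₀ : ℕ, K₀min ≤ K₀ →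
      ∀ (P : HiggsLattice.Params), P.d = d → P.L = L → K₀ ∣ P.M → 3 * K₀ ≤ 2 * P.M →
      ∀ {K : ℕ}, 1 ≤ K → K ≤ P.K → P.mesh K ≤ ε₀ →
      ∀ (A : HiggsLattice.VecField P 0) {ec : ℝ}, 0 < ec → ec ≤ e₁ K₀ →
      (∀ (x : HiggsLattice.Site P 0) (μ ν : Fin P.d),
          P.mesh K * |C.e| / ec * |A ⟨x.shift μ, ν⟩ - A ⟨x, ν⟩| ≤ creg * ec ^ (β - 1) / (P.L : ℝ) ^ K) →
        ∀ (g : HiggsLattice.ScalarField P 0 N) (M D : ℝ), (∀ x, ‖g x‖ ≤ M) → 0 ≤ D →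
          ∀ x, (∀ z, g z ≠ 0 → D ≤ (HiggsLattice.Site.tdist x z : ℝ)) →
            ‖propagatorK C Finset.univ A msq a K g x‖ ≤ c₀ * P.mesh K ^ 2 * Real.exp (-(δA K₀ * (D / (P.L : ℝ) ^ K))) * M := by
  obtain ⟨c₀, hc₀, K₀min, e₁, δA, hcδ, h⟩ := norm_propagatorK_reg_decay_of_cubes d L hL ha hmsq N C ε₀ creg β hcreg hβ
  exact ⟨c₀, hc₀, K₀min, e₁, δA, hcδ, fun K₀ hK₀ P hPd hPL hK₀M h3M K hK1 hK hε A ec hec hle hreg g M D hg hD0 x hD =>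
    h K₀ hK₀ P hPd hPL hK₀M hK1 hK (three_half_le_sites hK h3M) hε A hec hle hreg g M D hg hD0 x hD⟩

/-- **(2.25) DERIVATIVE MEMBER AT EVERY REGULAR `A`, CUBE CONDITION AS «`K₀ ∣ M`, `3K₀ ≦ 2M`»**.
[cite: Balaban1982Higgs1, Prop. 2.1 (2.23), (2.25) p.610] [cite: Balaban1983RegularityDecay, Theorem (1.10) p.573] -/
theorem norm_covDeriv_propagatorK_reg_decay (d L : ℕ) (hL : 2 ≤ L) {a : ℝ} (ha : 0 < a) {msq : ℝ} (hmsq : 0 < msq) (N : ℕ)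
    (C : ChargeData N) (ε₀ : ℝ) (creg β : ℝ) (hcreg : 0 ≤ creg) (hβ : 0 < β) :
    ∃ c₀ : ℝ, 0 < c₀ ∧ ∃ K₀min : ℕ, ∃ e₁ δA : ℕ → ℝ, (∀ K₀, 0 < e₁ K₀ ∧ 0 < δA K₀) ∧ ∀ K₀ : ℕ, K₀min ≤ K₀ →
      ∀ (P : HiggsLattice.Params), P.d = d → P.L = L → K₀ ∣ P.M → 3 * K₀ ≤ 2 * P.M →
      ∀ {K : ℕ}, 1 ≤ K → K ≤ P.K → P.mesh K ≤ ε₀ →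
      ∀ (A : HiggsLattice.VecField P 0) {ec : ℝ}, 0 < ec → ec ≤ e₁ K₀ →
      (∀ (x : HiggsLattice.Site P 0) (μ ν : Fin P.d),
          P.mesh K * |C.e| / ec * |A ⟨x.shift μ, ν⟩ - A ⟨x, ν⟩| ≤ creg * ec ^ (β - 1) / (P.L : ℝ) ^ K) →
        ∀ (g : HiggsLattice.ScalarField P 0 N) (M D : ℝ), (∀ x, ‖g x‖ ≤ M) → 0 ≤ D →
          ∀ b : HiggsLattice.PBond P 0, (∀ z, g z ≠ 0 → D ≤ (HiggsLattice.Site.tdist b.src z : ℝ)) →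
            ‖covDeriv C A (propagatorK C Finset.univ A msq a K g) b‖
              ≤ c₀ * P.mesh K * Real.exp (-(δA K₀ * (D / (P.L : ℝ) ^ K))) * M := by
  obtain ⟨c₀, hc₀, K₀min, e₁, δA, hcδ, h⟩ := norm_covDeriv_propagatorK_reg_decay_of_cubes d L hL ha hmsq N C ε₀ creg β hcreg hβ
  exact ⟨c₀, hc₀, K₀min, e₁, δA, hcδ, fun K₀ hK₀ P hPd hPL hK₀M h3M K hK1 hK hε A ec hec hle hreg g M D hg hD0 b hD =>
    h K₀ hK₀ P hPd hPL hK₀M hK1 hK (three_half_le_sites hK h3M) hε A hec hle hreg g M D hg hD0 b hD⟩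

end Main

end Literature.MathematicalPhysics.QuantumFieldTheory.Balaban1983to89.B1Ineq225RegularTorus
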